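import Mathlib
import HarnessLib
import Summits.Ventures.LatticeQCDFlow.Scoring.FlowSamplerAutocorrelation
import Summits.Ventures.LatticeQCDFlow.Scoring.IndepMHKernelPositive

/-!
# The flow sampler's KERNEL and OPERATOR agree on every reference measure; the exact flow sampler on
# `SU(n)^E`: nonnegative log-convex autocorrelations, `τ_N ≤ τ_W ≤ τ_int`, and the sandwich
# `(1 + ρ₁)/(2(1 − ρ₁)) ≤ τ_int ≤ e^{2δ} − 1/2` — unconditional

HONEST FRAMING: exact (Metropolis-corrected) sampling algorithms for lattice gauge theory;
figures of merit are autocorrelation/cost numbers at stated couplings and volumes; no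
continuum-physics claim.

Venture `LatticeQCDFlow` (cell pub-lqcd), topic `Scoring`; FANOUT row 8 (`s0-cpn-nemc`, GEN-11).
NEW WORK of the cell (a dictionary corollary and one composition), not a published result.  It
builds on `Scoring/IndepMHKernelPositive.lean` (the dictionary `kop (indepMH q w) = imhOp q w 1` and
the kernel-level positivity package: row 2's positivity of `imhOp` transported to row 30's kernel
`indepMH`), and instantiates it (§2) on the tree's exact flow-MCMC theorem
`Exactness.flowSampler_exact_doeblin` (`Exactness/ApproxTrivializingSampler.lean`, row 30,
UNCONDITIONAL since the Jacobian formula (3.9) is the tree theorem `jacobianFormula_holds`), next to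
row 8 GEN-10's ceiling `Scoring.tauInt_le_exp_of_doeblin` and summability
(`Scoring/DoeblinAutocorrelation.lean`, `Scoring/DoeblinGreenKubo.lean`).  Nothing is cited as a
fact; printed counterparts (Liu 1996; Madras–Slade 1993 Prop. 9.2.2; Lüscher 2010) are named only in
the files this one composes.

## What is proved

* §1 (reference-measure form of the dictionary; any measurable space, reference measure `μ`, target
  weight `p > 0` and model density `q̃ > 0` measurable with `q̃·μ` a probability law)
  **`kop_indepMH_withDensity_eq_imhOp`**: `kop (indepMH (q̃·μ) (p/q̃)) g = imhOp μ p q̃ g` for bounded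
  measurable `g`; **`kop_phi4FlowKernel_eq_imhOpPhi4`**: row 2's S0-A flow KERNEL
  (`Exactness/Phi4FlowSamplerErgodic.lean`: `phi4FlowKernel J λ q̃ = indepMH (q̃ dφ) (e^{−S}/q̃)`) has
  row 2's OPERATOR `imhOpPhi4 J λ q̃` as its transition operator `Scoring.kop` — so every `imhOpPhi4`
  statement of row 2 is a statement about `Scoring.autocov` of `phi4FlowKernel`.
* §2 **`flowSampler_autocorrelation_floor`** (lattice `SU(n)^E`, UNCONDITIONAL) — smooth action
  `S`, jointly smooth flow action `S̃_t = F t` with uniform defect `|𝓛_t S̃_t − S − Ċ_t| ≤ δ` of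
  Lüscher's equation (4.5) on `[0,1] × SU(n)^E`, `𝓕` integrating `−∂S̃_t`, `q = (𝓕_1)_* D[V]`: there
  is a measurable weight `w` with `e^{−2δ} ≤ w ≤ e^{2δ}` and `w · q = π := 𝒵⁻¹e^{−S}D[U]` such that
  the flow-MCMC kernel `K = indepMH q w` is EXACT for `π` and, for EVERY bounded measurable observable
  `f` (`C_f(t) = autocov K π f t`, `ρ(t) = C_f(t)/C_f(0)`): `0 ≤ C_f(t)` and
  `C_f(t+1)² ≤ C_f(t) · C_f(t+2)` for all `t` (no centring needed); and if `f` is `π`-centred, for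
  every `N`, `τ_N ≤ τ_W(N) ≤ τ_int(f)`, `ρ(1) < 1`, and
  `(1 + ρ(1))/(2(1 − ρ(1))) ≤ τ_int(f) ≤ e^{2δ} − 1/2`.

Reading (markdown): for the exact flow sampler built on an approximately trivializing flow, every
windowed autocorrelation figure (Γ-window or finite-`N` variance of the mean) of every bounded
observable is a certified LOWER bound on `τ_int`, at every volume at which the defect bound `δ`
holds, and `τ_int` itself is pinned between the AR(1) value through the observable's own `ρ(1)` and
`e^{2δ} − 1/2`.  How `δ` must grow with volume / coupling for a fixed architecture is theory-1's
subject (`TrivializingMaps/*`), not claimed here.  NOT CLAIMED: unbounded observables; estimator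
noise; any number of ours; HMC / heat bath (see `Scoring/ReversibleKernelTauIntFloor.lean`).
-/

noncomputable section

namespace Summit.Ventures.LatticeQCDFlow.Scoring

open MeasureTheory ProbabilityTheory Filter Finset Summit.Ventures.LatticeQCDFlow.Exactness
open scoped ENNReal Topology

variable {Ω : Type*} [MeasurableSpace Ω]

/-! ### §1 Reference-measure form of the dictionary: `kop (indepMH (q̃·μ) (p/q̃)) = imhOp μ p q̃`

Row 2's own setting: a reference measure `μ` (Lebesgue measure on `ℝ^Λ`
for S0-A), a target weight `p` and a model density `q̃` against `μ`, the kernel `indepMH (q̃·μ) (p/q̃)`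
(`Exactness/Phi4FlowSamplerErgodic.lean`: `phi4FlowKernel J λ q̃`) and the operator `imhOp μ p q̃`
(`imhOpPhi4 J λ q̃`): the transition operator of row 2's flow KERNEL is row 2's OPERATOR, so every
`imhOpPhi4` statement of rows 2 is a statement about `Scoring.kop`/`Scoring.autocov` of
`phi4FlowKernel`. -/

section Reference

variable {μ : Measure Ω} {p q : Ω → ℝ}

/-- **Reference-measure dictionary**: `kop (indepMH (q̃·μ) (p/q̃)) g = imhOp μ p q̃ g` for bounded
measurable `g` (`p, q̃ > 0` measurable, `q̃·μ` a probability law). -/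
theorem kop_indepMH_withDensity_eq_imhOp
    [IsProbabilityMeasure (μ.withDensity fun x => ENNReal.ofReal (q x))]
    (hpm : Measurable p) (hqm : Measurable q) (hp0 : ∀ x, 0 < p x) (hq0 : ∀ x, 0 < q x)
    {g : Ω → ℝ} (hg : Measurable g) {C : ℝ} (hC : ∀ x, |g x| ≤ C) :
    kop (indepMH (μ.withDensity fun x => ENNReal.ofReal (q x)) fun x => p x / q x) g
      = imhOp μ p q g := by
  funext x
  rw [kop_indepMH (w := fun z => p z / q z) (hpm.div hqm) (fun y => div_pos (hp0 y) (hq0 y)) hg hC x,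
    integral_withDensity_eq_integral_toReal_smul hqm.ennreal_ofReal
      (ae_of_all _ fun y => ENNReal.ofReal_lt_top)]
  unfold imhOp
  refine integral_congr_ae (ae_of_all _ fun y => ?_)
  show (ENNReal.ofReal (q y)).toReal • (imhAccept (fun x => p x / q x) x y * g y
      + (1 - imhAccept (fun x => p x / q x) x y) * g x)
    = (imhAcceptQ p q x y * g y + (1 - imhAcceptQ p q x y) * g x) * q y
  have ha : imhAccept (fun x => p x / q x) x y = imhAcceptQ p q x y := by
    unfold imhAccept imhAcceptQ
    have hpx := (hp0 x).ne'
    have hqx := (hq0 x).ne'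
    have hqy := (hq0 y).ne'
    congr 1
    field_simp
  rw [ENNReal.toReal_ofReal (hq0 y).le, smul_eq_mul, ha]
  ring

/-- **Row 2's lattice kernel and operator**: `kop (phi4FlowKernel J λ q̃) f = imhOpPhi4 J λ q̃ f` for
every bounded measurable `f` and every positive measurable model density `q̃` with `q̃ dφ` a
probability law. -/
theorem kop_phi4FlowKernel_eq_imhOpPhi4 {n : ℕ} (J : Fin (n + 1) → Fin (n + 1) → ℝ) (lam : ℝ)
    {qt : (Fin (n + 1) → ℝ) → ℝ} [IsProbabilityMeasure (flowModel qt)] (hqm : Measurable qt)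
    (hq0 : ∀ φ, 0 < qt φ) {f : (Fin (n + 1) → ℝ) → ℝ} (hf : Measurable f) {C : ℝ}
    (hC : ∀ φ, |f φ| ≤ C) :
    kop (phi4FlowKernel J lam qt) f = imhOpPhi4 J lam qt f := by
  haveI : IsProbabilityMeasure (volume.withDensity fun φ => ENNReal.ofReal (qt φ)) :=
    ‹IsProbabilityMeasure (flowModel qt)›
  rw [imhOpPhi4_eq_imhOp]
  show kop (indepMH (volume.withDensity fun φ => ENNReal.ofReal (qt φ))
    fun φ => gibbsWeight J lam φ / qt φ) f = _
  exact kop_indepMH_withDensity_eq_imhOp (μ := volume) (continuous_gibbsWeight J lam).measurable hqm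
    (gibbsWeight_pos J lam) hq0 hf hC

end Reference

/-! ### §2 The lattice: the exact flow sampler on `SU(n)^E` — UNCONDITIONAL -/

section Lattice

open Literature.MathematicalPhysics.QuantumFieldTheory
open Literature.MathematicalPhysics.QuantumFieldTheory.Luscher2010
open Summit.Ventures.LatticeQCDFlow.TrivializingMaps
open scoped Matrix Matrix.Norms.Frobenius ContDiff

variable {d L n : ℕ} [NeZero L]

/-- **Positivity, windows below `τ_int`, and the two-sided sandwich for the exact flow sampler —
UNCONDITIONAL.**  Smooth action `S`, jointly smooth flow action `S̃_t = F t` with uniform defect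
`|𝓛_t S̃_t − S − Ċ_t| ≤ δ` of Lüscher's equation (4.5) on `[0,1] × SU(n)^E`, `𝓕` integrating `−∂S̃_t`,
`q = (𝓕_1)_* D[V]`: there is a measurable weight `w` with `e^{−2δ} ≤ w ≤ e^{2δ}` and
`w · q = π := 𝒵⁻¹e^{−S}D[U]` such that the flow-MCMC kernel `K = indepMH q w` is EXACT for `π` and,
for EVERY bounded measurable observable `f` (`C_f(t) = autocov K π f t`, `ρ(t) = C_f(t)/C_f(0)`):
`0 ≤ C_f(t)` and `C_f(t+1)² ≤ C_f(t) C_f(t+2)` for all `t`; and if `f` is `π`-centred then for every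
`N`, `τ_N ≤ τ_W(N) ≤ τ_int(f)`, `ρ(1) < 1`, and
`(1 + ρ(1))/(2(1 − ρ(1))) ≤ τ_int(f) ≤ e^{2δ} − 1/2`. -/
theorem flowSampler_autocorrelation_floor (B : SuBasis n)
    {S : AmbConfig d L n → ℝ} (hS : ContDiff ℝ ∞ S) {F : ℝ → AmbConfig d L n → ℝ}
    (hF : ContDiff ℝ ∞ fun p : ℝ × AmbConfig d L n => F p.1 p.2)
    {Φ : ℝ → GaugeConfig d L (Matrix.specialUnitaryGroup (Fin n) ℂ) →
      GaugeConfig d L (Matrix.specialUnitaryGroup (Fin n) ℂ)}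
    (hΦ : IsFlowMap (fun t W => -linkGrad B (F t) W) Φ) {c : ℝ → ℝ} {δ : ℝ}
    (hδ : ∀ t ∈ Set.Icc (0 : ℝ) 1, ∀ U : GaugeConfig d L (Matrix.specialUnitaryGroup (Fin n) ℂ),
      |luscherL B S t (F t) (WilsonFlow.coeConfig U) - S (WilsonFlow.coeConfig U) - c t| ≤ δ)
    (q : Measure (GaugeConfig d L (Matrix.specialUnitaryGroup (Fin n) ℂ))) [IsProbabilityMeasure q]
    (hq : q = Measure.map (Φ 1) (trivialMeasure (Matrix.specialUnitaryGroup (Fin n) ℂ) d L)) :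
    ∃ w : GaugeConfig d L (Matrix.specialUnitaryGroup (Fin n) ℂ) → ℝ, Measurable w ∧
      (∀ U, Real.exp (-(2 * δ)) ≤ w U) ∧ (∀ U, w U ≤ Real.exp (2 * δ)) ∧
      (q.withDensity fun U => ENNReal.ofReal (w U)) =
        boltzmannMeasure (fun U : GaugeConfig d L (Matrix.specialUnitaryGroup (Fin n) ℂ) =>
          S (WilsonFlow.coeConfig U)) ∧
      Kernel.Invariant (indepMH q w)
        (boltzmannMeasure fun U : GaugeConfig d L (Matrix.specialUnitaryGroup (Fin n) ℂ) =>
          S (WilsonFlow.coeConfig U)) ∧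
      ∀ (f : GaugeConfig d L (Matrix.specialUnitaryGroup (Fin n) ℂ) → ℝ), Measurable f →
        ∀ C : ℝ, (∀ U, |f U| ≤ C) →
        (∀ t : ℕ, 0 ≤ autocov (indepMH q w)
            (boltzmannMeasure fun U : GaugeConfig d L (Matrix.specialUnitaryGroup (Fin n) ℂ) =>
              S (WilsonFlow.coeConfig U)) f t) ∧
        (∀ t : ℕ,
          autocov (indepMH q w)
              (boltzmannMeasure fun U : GaugeConfig d L (Matrix.specialUnitaryGroup (Fin n) ℂ) =>
                S (WilsonFlow.coeConfig U)) f (t + 1) ^ 2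
            ≤ autocov (indepMH q w)
                (boltzmannMeasure fun U : GaugeConfig d L (Matrix.specialUnitaryGroup (Fin n) ℂ) =>
                  S (WilsonFlow.coeConfig U)) f t
              * autocov (indepMH q w)
                (boltzmannMeasure fun U : GaugeConfig d L (Matrix.specialUnitaryGroup (Fin n) ℂ) =>
                  S (WilsonFlow.coeConfig U)) f (t + 2)) ∧
        (∫ U, f U ∂(boltzmannMeasure fun U : GaugeConfig d L (Matrix.specialUnitaryGroup (Fin n) ℂ) =>
            S (WilsonFlow.coeConfig U)) = 0 →
          (∀ N : ℕ,
            tauIntN (fun t =>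
                autocov (indepMH q w)
                    (boltzmannMeasure fun U : GaugeConfig d L (Matrix.specialUnitaryGroup (Fin n) ℂ) =>
                      S (WilsonFlow.coeConfig U)) f t /
                  autocov (indepMH q w)
                    (boltzmannMeasure fun U : GaugeConfig d L (Matrix.specialUnitaryGroup (Fin n) ℂ) =>
                      S (WilsonFlow.coeConfig U)) f 0) N
              ≤ tauIntWindow (fun t =>
                autocov (indepMH q w)
                    (boltzmannMeasure fun U : GaugeConfig d L (Matrix.specialUnitaryGroup (Fin n) ℂ) =>
                      S (WilsonFlow.coeConfig U)) f t /
                  autocov (indepMH q w)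
                    (boltzmannMeasure fun U : GaugeConfig d L (Matrix.specialUnitaryGroup (Fin n) ℂ) =>
                      S (WilsonFlow.coeConfig U)) f 0) N ∧
            tauIntWindow (fun t =>
                autocov (indepMH q w)
                    (boltzmannMeasure fun U : GaugeConfig d L (Matrix.specialUnitaryGroup (Fin n) ℂ) =>
                      S (WilsonFlow.coeConfig U)) f t /
                  autocov (indepMH q w)
                    (boltzmannMeasure fun U : GaugeConfig d L (Matrix.specialUnitaryGroup (Fin n) ℂ) =>
                      S (WilsonFlow.coeConfig U)) f 0) N
              ≤ tauInt (fun t =>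
                autocov (indepMH q w)
                    (boltzmannMeasure fun U : GaugeConfig d L (Matrix.specialUnitaryGroup (Fin n) ℂ) =>
                      S (WilsonFlow.coeConfig U)) f t /
                  autocov (indepMH q w)
                    (boltzmannMeasure fun U : GaugeConfig d L (Matrix.specialUnitaryGroup (Fin n) ℂ) =>
                      S (WilsonFlow.coeConfig U)) f 0)) ∧
          autocov (indepMH q w)
                (boltzmannMeasure fun U : GaugeConfig d L (Matrix.specialUnitaryGroup (Fin n) ℂ) =>
                  S (WilsonFlow.coeConfig U)) f 1 /
              autocov (indepMH q w)
                (boltzmannMeasure fun U : GaugeConfig d L (Matrix.specialUnitaryGroup (Fin n) ℂ) =>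
                  S (WilsonFlow.coeConfig U)) f 0 < 1 ∧
          (1 + autocov (indepMH q w)
                (boltzmannMeasure fun U : GaugeConfig d L (Matrix.specialUnitaryGroup (Fin n) ℂ) =>
                  S (WilsonFlow.coeConfig U)) f 1 /
              autocov (indepMH q w)
                (boltzmannMeasure fun U : GaugeConfig d L (Matrix.specialUnitaryGroup (Fin n) ℂ) =>
                  S (WilsonFlow.coeConfig U)) f 0) /
            (2 * (1 - autocov (indepMH q w)
                (boltzmannMeasure fun U : GaugeConfig d L (Matrix.specialUnitaryGroup (Fin n) ℂ) =>
                  S (WilsonFlow.coeConfig U)) f 1 /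
              autocov (indepMH q w)
                (boltzmannMeasure fun U : GaugeConfig d L (Matrix.specialUnitaryGroup (Fin n) ℂ) =>
                  S (WilsonFlow.coeConfig U)) f 0))
            ≤ tauInt (fun t =>
                autocov (indepMH q w)
                    (boltzmannMeasure fun U : GaugeConfig d L (Matrix.specialUnitaryGroup (Fin n) ℂ) =>
                      S (WilsonFlow.coeConfig U)) f t /
                  autocov (indepMH q w)
                    (boltzmannMeasure fun U : GaugeConfig d L (Matrix.specialUnitaryGroup (Fin n) ℂ) =>
                      S (WilsonFlow.coeConfig U)) f 0) ∧
          tauInt (fun t =>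
                autocov (indepMH q w)
                    (boltzmannMeasure fun U : GaugeConfig d L (Matrix.specialUnitaryGroup (Fin n) ℂ) =>
                      S (WilsonFlow.coeConfig U)) f t /
                  autocov (indepMH q w)
                    (boltzmannMeasure fun U : GaugeConfig d L (Matrix.specialUnitaryGroup (Fin n) ℂ) =>
                      S (WilsonFlow.coeConfig U)) f 0)
            ≤ Real.exp (2 * δ) - 1 / 2) := by
  obtain ⟨w, hw, hlo, hhi, hπ, hinv, -, hdoeb⟩ := flowSampler_exact_doeblin B hS hF hΦ hδ q hq
  haveI : Fact (Measurable w) := ⟨hw⟩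
  have hS'c : Continuous fun U : GaugeConfig d L (Matrix.specialUnitaryGroup (Fin n) ℂ) =>
      S (WilsonFlow.coeConfig U) := hS.continuous.comp WilsonFlow.continuous_coeConfig
  haveI := isProbabilityMeasure_boltzmannMeasure (d := d) (L := L) hS'c
  have hε0 : 0 < ENNReal.ofReal (Real.exp (-(2 * δ))) := ENNReal.ofReal_pos.2 (Real.exp_pos _)
  have hw0 : ∀ U, 0 < w U := fun U => (Real.exp_pos _).trans_le (hlo U)
  have hwi : Integrable w q :=
    integrable_of_bounded q hw (C := Real.exp (2 * δ)) fun U => by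
      rw [abs_of_pos (hw0 U)]; exact hhi U
  refine ⟨w, hw, hlo, hhi, hπ, hinv, fun f hf C hC =>
    ⟨indepMH_autocov_nonneg hw hw0 hwi hπ hf hC, indepMH_autocov_logConvex hw hw0 hwi hπ hf hC,
      fun hf0 => ?_⟩⟩
  -- summability of the lag series from the Doeblin envelope (row 8 GEN-10)
  set πS := boltzmannMeasure (fun U : GaugeConfig d L (Matrix.specialUnitaryGroup (Fin n) ℂ) =>
    S (WilsonFlow.coeConfig U)) with hπS
  have hsum : Summable fun t => autocov (indepMH q w) πS f (t + 1) / autocov (indepMH q w) πS f 0 :=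
    summable_succ_of_summable_moment
      (ρ := fun t => autocov (indepMH q w) πS f t / autocov (indepMH q w) πS f 0)
      (summable_moment_acf_of_doeblin hinv (fun x B hB => hdoeb x hB) hε0 hf hC hf0)
  obtain ⟨hρ1, hfloor⟩ := indepMH_tauInt_floor hw hw0 hwi hπ hf hC hsum
  refine ⟨fun N => ⟨indepMH_tauIntN_le_tauIntWindow hw hw0 hwi hπ hf hC N,
    indepMH_tauIntWindow_le_tauInt hw hw0 hwi hπ hf hC hsum N⟩, hρ1, hfloor, ?_⟩
  exact tauInt_le_exp_of_doeblin (M := 2 * δ) hinv (fun x B hB => hdoeb x hB) hf hC hf0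

end Lattice

end Summit.Ventures.LatticeQCDFlow.Scoring

end
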